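import Summits.QuantumFields.YangMills.Theorems.BalabanUVNodesN08AlphaAbelianAverage

/-!
# Route «BalabanUVNodes», Track-A DAG node N08 = [Balaban1985UV3] — (α) clause, the in-edge sentence (b11‴) CONSTRUCTED, part 2b:
# THE WINDOW OF A COARSE PLAQUETTE — locality and size of the curvature of the iterated linear average

Cell `pub-ymgap`, seat `pub-ymgap-dag-n08-d` gen 5, file F2b (over F2 `…N08AlphaAbelianAverage`).  `bears_on: R4∕N08`; filed `--supports
stmt-QuantumFields-19910 --as helper`.  Sorry-free, standard axioms.

CONTENTS ([folklore] bookkeeping from F2's one-step identity `curl_linAvgR`): the curvature `curl(linAvgIter L a j)(z; μ,ν)` of the `j`-fold linear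
average at the coarse plaquette `(z; μ,ν)`
* depends on `curl a` only through its values on the FINE WINDOW `[L^j z, L^j z + (L^j − 1)𝟙 + (L^j − 1)(e_μ + e_ν)]` — the union of the four corner
  blocks `B^j(z) ∪ B^j(z+e_μ) ∪ B^j(z+e_ν) ∪ B^j(z+e_μ+e_ν)` = print's `Δ′(p′)` (69) p. 273 — (`curl_linAvgIter_congr`), and
* is at most `(L^j)² ×` the largest fine `|curl a|` on that window (`abs_curl_linAvgIter_le`).
HONEST FRAMING: kernel bookkeeping for TEST configurations; nothing of [B10] ∕ [7] ∕ [4]'s estimates asserted; count-neutral; NOT a discharge of N08.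
-/

noncomputable section

namespace Summit.QuantumFields.YangMills.Theorems.BalabanUVNodesN08AlphaAbelianWindow

open scoped BigOperators
open Literature.MathematicalPhysics.QuantumFieldTheory.Balaban1983to89
open B7Prop1Explicit
open B7Prop2Explicit (rescale rescale_apply)
open Summit.QuantumFields.YangMills.Theorems.BalabanUVNodesN08AlphaAbelianLift
open Summit.QuantumFields.YangMills.Theorems.BalabanUVNodesN08AlphaAbelianAverage

variable {d : ℕ} (L : ℕ)

/-- **THE FINE WINDOW OF THE COARSE PLAQUETTE `(z; μ,ν)` AT LEVEL `j`**: `x` with `L^j z_i ≤ x_i ≤ L^j z_i + (L^j − 1) + (L^j − 1)([i = μ] + [i = ν])`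
(the four corner blocks, print's `Δ′(p′)`). [cite: Balaban1985UV3, (69) p.273] -/
def InWindow (j : ℕ) (z : Site d) (μ ν : Fin d) (x : Site d) : Prop :=
  ∀ i, (L : ℤ) ^ j * z i ≤ x i ∧
    x i ≤ (L : ℤ) ^ j * z i + ((L : ℤ) ^ j - 1) + (if i = μ then (L : ℤ) ^ j - 1 else 0) + (if i = ν then (L : ℤ) ^ j - 1 else 0)

/-- At level `0` the window is the point `z`. [folklore] -/
theorem inWindow_zero_iff (z : Site d) (μ ν : Fin d) (x : Site d) : InWindow L 0 z μ ν x ↔ x = z := by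
  constructor
  · intro h; funext i; have := h i; simp only [pow_zero, one_mul, sub_self, ite_self, add_zero] at this; omega
  · rintro rfl i; simp

/-- **Windows nest along the one-step recursion**: the level-`j` window of `Lz + r + ie_μ + j′e_ν` (`r ∈ [0,L)^d`, `i, j′ < L`) lies in the
level-`(j+1)` window of `z`. [folklore] -/
theorem inWindow_succ_of_inWindow (hL : 1 ≤ L) (j : ℕ) (z : Site d) (μ ν : Fin d) (r : Fin d → Fin L) {i j' : ℕ} (hi : i < L) (hj' : j' < L)
    {x : Site d} (hx : InWindow L j ((L : ℤ) • z + boxVec L r + (i : ℤ) • e μ + (j' : ℤ) • e ν) μ ν x) :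
    InWindow L (j + 1) z μ ν x := by
  intro k
  have h := hx k
  have hr := (r k).isLt
  have hLj : (1 : ℤ) ≤ (L : ℤ) ^ j := by exact_mod_cast Nat.one_le_pow _ _ hL
  have hL1 : (1 : ℤ) ≤ (L : ℤ) := by exact_mod_cast hL
  simp only [Pi.add_apply, Pi.smul_apply, smul_eq_mul, e_apply, boxVec, mul_ite, mul_one, mul_zero] at h
  rw [pow_succ]
  constructor
  · have h1 := h.1
    split_ifs at h1 <;> nlinarith
  · have h2 := h.2
    have hi' : (i : ℤ) ≤ L - 1 := by omega
    have hj'' : (j' : ℤ) ≤ L - 1 := by omega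
    have hr' : ((r k : ℕ) : ℤ) ≤ L - 1 := by omega
    split_ifs at h2 ⊢ <;> nlinarith

/-- **★ LOCALITY OF THE ITERATED CURVATURE**: if `curl a` and `curl a′` agree on the fine window of `(z; μ,ν)` at level `j`, the `j`-fold linear
averages have the same curl at `(z; μ,ν)`. [cite: Balaban1985Averaging, p.24 (locality) + (48) p.25] -/
theorem curl_linAvgIter_congr (hL : 1 ≤ L) {a a' : Site d → Fin d → ℝ} (μ ν : Fin d) :
    ∀ (j : ℕ) (z : Site d), (∀ x, InWindow L j z μ ν x → curl a x μ ν = curl a' x μ ν) →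
      curl (linAvgIter L a j) z μ ν = curl (linAvgIter L a' j) z μ ν
  | 0, z, h => by simpa using h z ((inWindow_zero_iff L z μ ν z).2 rfl)
  | j + 1, z, h => by
    rw [linAvgIter_succ, linAvgIter_succ, curl_linAvgR, curl_linAvgR]
    congr 1
    refine Finset.sum_congr rfl fun r _ => Finset.sum_congr rfl fun i hi => Finset.sum_congr rfl fun j' hj' => ?_
    rw [Finset.mem_range] at hi hj'
    exact curl_linAvgIter_congr hL μ ν j _ fun x hx => h x (inWindow_succ_of_inWindow L hL j z μ ν r hi hj' hx)

/-- **★ SIZE OF THE ITERATED CURVATURE**: if `|curl a| ≤ m` on the fine window of `(z; μ,ν)` at level `j`, then `|curl(linAvgIter L a j)(z; μ,ν)| ≤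
(L^j)²·m` (each averaging step multiplies by at most `L²`: `L^d` offsets × `L²` plaquettes, weight `L^{−d}`). [cite: Balaban1985Averaging, (49)–(51) pp.25–26] -/
theorem abs_curl_linAvgIter_le (hL : 1 ≤ L) {a : Site d → Fin d → ℝ} (μ ν : Fin d) {m : ℝ} (hm : 0 ≤ m) :
    ∀ (j : ℕ) (z : Site d), (∀ x, InWindow L j z μ ν x → |curl a x μ ν| ≤ m) →
      |curl (linAvgIter L a j) z μ ν| ≤ ((L : ℝ) ^ j) ^ 2 * m
  | 0, z, h => by simpa using h z ((inWindow_zero_iff L z μ ν z).2 rfl)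
  | j + 1, z, h => by
    rw [linAvgIter_succ, curl_linAvgR, abs_mul, abs_inv, abs_of_nonneg (by positivity : (0 : ℝ) ≤ (L : ℝ) ^ d)]
    have hL0 : (0 : ℝ) < (L : ℝ) ^ d := by
      have : (0 : ℝ) < L := by exact_mod_cast (show 0 < L by omega)
      positivity
    have hterm : ∀ (r : Fin d → Fin L), ∀ i ∈ Finset.range L, ∀ j' ∈ Finset.range L,
        |curl (linAvgIter L a j) ((L : ℤ) • z + boxVec L r + (i : ℤ) • e μ + (j' : ℤ) • e ν) μ ν| ≤ ((L : ℝ) ^ j) ^ 2 * m := by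
      intro r i hi j' hj'
      rw [Finset.mem_range] at hi hj'
      exact abs_curl_linAvgIter_le hL μ ν hm j _ fun x hx => h x (inWindow_succ_of_inWindow L hL j z μ ν r hi hj' hx)
    have hsum : |∑ r : Fin d → Fin L, ∑ i ∈ Finset.range L, ∑ j' ∈ Finset.range L,
        curl (linAvgIter L a j) ((L : ℤ) • z + boxVec L r + (i : ℤ) • e μ + (j' : ℤ) • e ν) μ ν| ≤
        (L : ℝ) ^ d * ((L : ℝ) * ((L : ℝ) * (((L : ℝ) ^ j) ^ 2 * m))) := by
      refine (Finset.abs_sum_le_sum_abs _ _).trans ?_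
      have hcard : (Finset.univ : Finset (Fin d → Fin L)).card = L ^ d := by
        rw [Finset.card_univ, Fintype.card_fun, Fintype.card_fin, Fintype.card_fin]
      calc ∑ r : Fin d → Fin L, |∑ i ∈ Finset.range L, ∑ j' ∈ Finset.range L,
              curl (linAvgIter L a j) ((L : ℤ) • z + boxVec L r + (i : ℤ) • e μ + (j' : ℤ) • e ν) μ ν|
          ≤ ∑ _r : Fin d → Fin L, (L : ℝ) * ((L : ℝ) * (((L : ℝ) ^ j) ^ 2 * m)) := by
            refine Finset.sum_le_sum fun r _ => (Finset.abs_sum_le_sum_abs _ _).trans ?_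
            calc ∑ i ∈ Finset.range L, |∑ j' ∈ Finset.range L,
                    curl (linAvgIter L a j) ((L : ℤ) • z + boxVec L r + (i : ℤ) • e μ + (j' : ℤ) • e ν) μ ν|
                ≤ ∑ _i ∈ Finset.range L, (L : ℝ) * (((L : ℝ) ^ j) ^ 2 * m) := by
                  refine Finset.sum_le_sum fun i hi => (Finset.abs_sum_le_sum_abs _ _).trans ?_
                  calc ∑ j' ∈ Finset.range L, |curl (linAvgIter L a j) ((L : ℤ) • z + boxVec L r + (i : ℤ) • e μ + (j' : ℤ) • e ν) μ ν|
                      ≤ ∑ _j' ∈ Finset.range L, ((L : ℝ) ^ j) ^ 2 * m := Finset.sum_le_sum fun j' hj' => hterm r i hi j' hj'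
                    _ = (L : ℝ) * (((L : ℝ) ^ j) ^ 2 * m) := by rw [Finset.sum_const, Finset.card_range, nsmul_eq_mul]
              _ = (L : ℝ) * ((L : ℝ) * (((L : ℝ) ^ j) ^ 2 * m)) := by rw [Finset.sum_const, Finset.card_range, nsmul_eq_mul]
        _ = (L : ℝ) ^ d * ((L : ℝ) * ((L : ℝ) * (((L : ℝ) ^ j) ^ 2 * m))) := by
            rw [Finset.sum_const, hcard, nsmul_eq_mul]; push_cast; ring
    calc ((L : ℝ) ^ d)⁻¹ * |∑ r : Fin d → Fin L, ∑ i ∈ Finset.range L, ∑ j' ∈ Finset.range L,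
            curl (linAvgIter L a j) ((L : ℤ) • z + boxVec L r + (i : ℤ) • e μ + (j' : ℤ) • e ν) μ ν|
        ≤ ((L : ℝ) ^ d)⁻¹ * ((L : ℝ) ^ d * ((L : ℝ) * ((L : ℝ) * (((L : ℝ) ^ j) ^ 2 * m)))) := by gcongr
      _ = ((L : ℝ) ^ (j + 1)) ^ 2 * m := by field_simp; ring

end Summit.QuantumFields.YangMills.Theorems.BalabanUVNodesN08AlphaAbelianWindow

end
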